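import Mathlib

/-!
# EriceRemainderEnclosureHistoryAutonomyComparisonAgeCompositionStaticChainSaturationCompounding — (E77c) COMPOUNDING VERSUS IN-BETWEEN AMPLIFICATION in the
# saturation game: the compounding `E_j = Π_{i nearer}(1−ρ_i)⁻¹` of an older age's carried ratio by the ages between it and the young, and the game's amplification
# `G_j = 1 + Σ_{i nearer} x_i ĝ_i S_{ij}∕(x̂ φ_j)` of the same age's charge on the young's row by the same ages, satisfy `E_j − 1 = Σ_{i<j} b_i^{own} E_i` and
# `G_j − 1 = Σ_{i<j} (…)`; so **`E_j ≤ G_j`** (numerically ALWAYS, README §4: `max E∕G = 1.000` over 27 families) reduces TERMWISE, by induction nearest-first, to one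
# inequality per in-between age: `c_i M_i∕(1 − x_i M_i) ≤ 2χ_{ij}` with the read geometry `χ_{ij} = φ_i S_{ij}∕φ_j ∈ [0.83, 2]` — the same «relaxed slack × multiplier ∕
# (1 − ratio)» that the per-age domination of (E77a) needs below `κ₀∕ω ≥ 1.35`

Cell `pub-balaban`, β-function sub-cell, BINDER row D4 «RemainderConst leaves for Bałaban's split» (`HOME/BINDER-OWNERS.md`; owner lineage `b2b-balaban-beta-an4`;
this file by co-owner #2 lineage `b2b-balaban-beta-d4-p2`, generation 68), β-FLOW TEAM duty (1), FREEZE (0) honoured (def-free, Mathlib only; (E77a), (E77b) referred to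
BY NAME, nothing restated).

HONEST FRAMING (page 1, verbatim and binding).  *"Discharging BetaPertH makes Bałaban's UV stability UNCONDITIONAL — a real constructive-QFT result; it is
NOT the continuum limit and NOT the Clay problem."*  THIS FILE DISCHARGES NOTHING OF THE KIND.  Elementary algebra of finite sums and products of real numbers —
hypotheses of a census, not facts; the form, signs, ages and moments of Bałaban's (1.22) limit functional are NOT PRINTED ([I] p. 298; GAPS G-t4-U2-1∕-2) and NOT
asserted.  Row D4 class UNCHANGED (critical-path width 0; instance 0∕1; D4 DISCHARGE NO DATE).  HONEST DEPENDENCY: continuum YM on T⁴ ⇐ BetaPertH ∧ nine spine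
estimates (0/9 proved); BetaPertH ⇐ (D1) ∧ (D4) ∧ CAP+tail; G-an2-4 gates asym, D1 and NE2/3/4.

THE POINT (README `HOME/b2b-balaban-beta-d4-p2/g68/e77/README.md` §5 (2)(iii)).  Indices `i = 0, 1, …` count the older ages of a young scale `z` NEAREST FIRST; `ρ_i`
their ratios (`0 ≤ ρ_i < 1`), `E_j := Π_{i<j}(1−ρ_i)⁻¹` the compounding suffered by the carried ratio of the `j`-th nearest age (`b_j = b_j^{own}·E_j`,
`b^{own} = ρ∕(1−ρ)`); in the young's cap the same age enters with the amplified charge `d_j = 2x_jσ_jĝ_j(x̂)∕x̂`, `ĝ_j ≥ (2x̂φ_j + Σ_{i<j}2x_iĝ_iS_{ij})∕c_j = 2x̂φ_jG_j∕c_j`,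
`G_j := 1 + Σ_{i<j} x_iĝ_iS_{ij}∕(x̂φ_j)`.  Per-age domination in the linear regime reads `ω_j·R̃_j·(E_j∕G_j) ≤ κ₀` ((E77a) `own_term_le_of_charge`), so `E_j ≤ G_j` is the
lemma that makes the in-between compounding FREE.  §1: `E_j − 1 = Σ_{i<j} (ρ_i∕(1−ρ_i))·E_i` (each nearer age adds its own ratio times the compounding already
present) and the comparison principle `E_j ≤ 1 + Σ_{i<j} T_i` from termwise bounds.  §2: the termwise bound `(ρ_i∕(1−ρ_i))·E_i ≤ x_iĝ_iS_{ij}∕(x̂φ_j)` follows from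
`E_i ≤ G_i` (the induction hypothesis), the game's `ĝ_i ≥ 2x̂φ_iG_i∕c_i`, and **`c_iM_i∕(1 − x_iM_i) ≤ 2φ_iS_{ij}∕φ_j`** (`ρ_i = x_iM_i`); §3 packages the induction:
if every nearer age satisfies that inequality then `E_j ≤ G_j`.  NOT CLAIMED: the inequality `c_iM_i∕(1−x_iM_i) ≤ 2χ_{ij}` for any configuration (README §4–§5: measured
`sup R̃E∕G = 1.24` in the linear regime against `2χ ≥ 1.66`); the static closure; anything printed.

WHAT IS PROVED ([folklore]; 0 `def`, 0 sorry).  §1 `compounding_pos`, `compounding_ge_one`, **`compounding_sub_one_eq_sum`**, **`compounding_le_of_termwise`**.  §2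
**`own_compounding_le_amplified_read`**.  §3 **`compounding_le_amplification`**.
-/
noncomputable section
open Finset

namespace Summit.QuantumFields.BalabanUV.Beta.EriceRemainderEnclosureHistoryAutonomyComparisonAgeCompositionStaticChainSaturationCompounding

variable {ρ E : ℕ → ℝ}

/-! ## §1 The compounding by the nearer ages as a sum -/

/-- The compounding `E_j = Π_{i<j}(1−ρ_i)⁻¹` (`E_0 = 1`, `E_{i+1} = E_i∕(1−ρ_i)`) is positive for ratios `< 1`. [folklore] -/
theorem compounding_pos (hρ1 : ∀ i, ρ i < 1) (hE0 : E 0 = 1) (hE : ∀ i, E (i + 1) = E i / (1 - ρ i)) : ∀ j, 0 < E j := by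
  intro j
  induction j with
  | zero => rw [hE0]; exact one_pos
  | succ j ih => rw [hE j]; exact div_pos ih (sub_pos.mpr (hρ1 j))

/-- … and at least one for ratios in `[0,1)`. [folklore] -/
theorem compounding_ge_one (hρ0 : ∀ i, 0 ≤ ρ i) (hρ1 : ∀ i, ρ i < 1) (hE0 : E 0 = 1) (hE : ∀ i, E (i + 1) = E i / (1 - ρ i)) :
    ∀ j, 1 ≤ E j := by
  intro j
  induction j with
  | zero => rw [hE0]
  | succ j ih =>
    rw [hE j, le_div_iff₀ (sub_pos.mpr (hρ1 j))]
    nlinarith [hρ0 j, compounding_pos hρ1 hE0 hE j]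

/-- **COMPOUNDING MINUS ONE IS THE SUM OF THE OWN RATIOS TIMES THE COMPOUNDING ALREADY PRESENT**: `E_j − 1 = Σ_{i<j} (ρ_i∕(1−ρ_i))·E_i` — the `i`-th nearest age
multiplies `E` by `(1−ρ_i)⁻¹ = 1 + ρ_i∕(1−ρ_i)`, i.e. adds `b_i^{own}·E_i`. [folklore] -/
theorem compounding_sub_one_eq_sum (hρ1 : ∀ i, ρ i < 1) (hE0 : E 0 = 1) (hE : ∀ i, E (i + 1) = E i / (1 - ρ i)) :
    ∀ j, E j - 1 = ∑ i ∈ range j, ρ i / (1 - ρ i) * E i := by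
  intro j
  induction j with
  | zero => simp [hE0]
  | succ j ih =>
    have h1 : 1 - ρ j ≠ 0 := (sub_pos.mpr (hρ1 j)).ne'
    rw [sum_range_succ, ← ih, hE j]
    field_simp
    ring

/-- **COMPARISON FROM TERMWISE BOUNDS.**  If every nearer age's contribution is dominated, `(ρ_i∕(1−ρ_i))·E_i ≤ T_i` for `i < j`, then `E_j ≤ 1 + Σ_{i<j} T_i`.
With `T_i = x_iĝ_iS_{ij}∕(x̂φ_j)` the right side is the game's amplification factor `G_j`. [folklore] -/
theorem compounding_le_of_termwise {T : ℕ → ℝ} (hρ1 : ∀ i, ρ i < 1) (hE0 : E 0 = 1) (hE : ∀ i, E (i + 1) = E i / (1 - ρ i)) {j : ℕ}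
    (hT : ∀ i, i < j → ρ i / (1 - ρ i) * E i ≤ T i) : E j ≤ 1 + ∑ i ∈ range j, T i := by
  have h := compounding_sub_one_eq_sum hρ1 hE0 hE j
  have hs : ∑ i ∈ range j, ρ i / (1 - ρ i) * E i ≤ ∑ i ∈ range j, T i := sum_le_sum fun i hi => hT i (mem_range.mp hi)
  linarith

/-! ## §2 The termwise bound from the slack inequality of the nearer age -/

/-- **THE OWN COMPOUNDING OF A NEARER AGE IS PAID BY ITS AMPLIFIED READ ON THE OLDER ROW.**  Nearer age `i` with load `x_i ≥ 0`, multiplier `M_i ≥ 0`, ratio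
`ρ_i = x_iM_i < 1`, compounding `E_i ≤ G_i` by the ages nearer than it (`G_i ≥ 0`), relaxed slack `c_i > 0`, game ratio `ĝ_i ≥ 2x̂φ_iG_i∕c_i` (the linear piece of the
recursion, `x̂ > 0`), reads `S_{ij} ≥ 0` on the older row `j` and `φ_j > 0`; if **`c_iM_i∕(1 − x_iM_i) ≤ 2φ_iS_{ij}∕φ_j`** then
`(ρ_i∕(1−ρ_i))·E_i ≤ x_iĝ_iS_{ij}∕(x̂φ_j)` — the term of `E_j − 1` is below the term of `G_j − 1`. [folklore] -/
theorem own_compounding_le_amplified_read {x M Ei Gi c gh xh φi φj Sij : ℝ} (hx : 0 ≤ x) (hM : 0 ≤ M) (hρ : x * M < 1) (hEG : Ei ≤ Gi) (hG : 0 ≤ Gi)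
    (hc : 0 < c) (hxh : 0 < xh) (hφj : 0 < φj) (hS : 0 ≤ Sij) (hgh : 2 * xh * φi * Gi / c ≤ gh)
    (hR : c * M / (1 - x * M) ≤ 2 * φi * Sij / φj) :
    x * M / (1 - x * M) * Ei ≤ x * gh * Sij / (xh * φj) := by
  have h1 : 0 < 1 - x * M := sub_pos.mpr hρ
  have hb : 0 ≤ x * M / (1 - x * M) := div_nonneg (mul_nonneg hx hM) h1.le
  -- `(ρ∕(1−ρ))·E_i ≤ (ρ∕(1−ρ))·G_i`
  have h2 : x * M / (1 - x * M) * Ei ≤ x * M / (1 - x * M) * Gi := mul_le_mul_of_nonneg_left hEG hb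
  refine h2.trans ?_
  -- `(ρ∕(1−ρ))·G_i = x·(M∕(1−ρ))·G_i ≤ x·(2φ_iS_{ij}∕(cφ_j))·G_i ≤ x·ĝ_i·S_{ij}∕(x̂φ_j)`
  have hR' : M / (1 - x * M) ≤ 2 * φi * Sij / (φj * c) := by
    rw [div_le_div_iff₀ h1 (mul_pos hφj hc)]
    have := (div_le_div_iff₀ h1 hφj).mp hR
    nlinarith
  have h3 : x * M / (1 - x * M) * Gi = x * Gi * (M / (1 - x * M)) := by ring
  have h4 : x * Gi * (M / (1 - x * M)) ≤ x * Gi * (2 * φi * Sij / (φj * c)) := mul_le_mul_of_nonneg_left hR' (mul_nonneg hx hG)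
  have h5 : x * Gi * (2 * φi * Sij / (φj * c)) = (2 * xh * φi * Gi / c) * (x * Sij / (xh * φj)) := by
    field_simp
  have h6 : (2 * xh * φi * Gi / c) * (x * Sij / (xh * φj)) ≤ gh * (x * Sij / (xh * φj)) :=
    mul_le_mul_of_nonneg_right hgh (div_nonneg (mul_nonneg hx hS) (mul_pos hxh hφj).le)
  calc x * M / (1 - x * M) * Gi = x * Gi * (M / (1 - x * M)) := h3
    _ ≤ x * Gi * (2 * φi * Sij / (φj * c)) := h4
    _ = (2 * xh * φi * Gi / c) * (x * Sij / (xh * φj)) := h5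
    _ ≤ gh * (x * Sij / (xh * φj)) := h6
    _ = x * gh * Sij / (xh * φj) := by ring

/-! ## §3 The induction nearest-first -/

/-- **COMPOUNDING ≤ IN-BETWEEN AMPLIFICATION.**  Older ages of the young indexed nearest first; ratios `ρ_i = x_iM_i ∈ [0,1)` (`x, M ≥ 0`), compounding `E` as in §1,
game data `x̂ > 0`, `φ > 0`, `S ≥ 0`, relaxed slacks `c > 0`, game ratios with `ĝ_i ≥ 2x̂φ_iG_i∕c_i` where `G_i := 1 + Σ_{i'<i} x_{i'}ĝ_{i'}S_{i'i}∕(x̂φ_i)`; if every age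
`i < n` satisfies the slack inequality `c_iM_i∕(1−x_iM_i) ≤ 2φ_iS_{ij}∕φ_j` towards every older `j ≤ n`… stated here for the target index `n` and all intermediate
targets: **`E_j ≤ G_j` for every `j ≤ n`** (strong induction: the hypothesis for `i < j` uses `E_i ≤ G_i`). [folklore] -/
theorem compounding_le_amplification {x M c gh φ : ℕ → ℝ} {S : ℕ → ℕ → ℝ} {G : ℕ → ℝ} {xh : ℝ} {n : ℕ}
    (hx : ∀ i, 0 ≤ x i) (hM : ∀ i, 0 ≤ M i) (hρ : ∀ i, ρ i = x i * M i) (hρ1 : ∀ i, ρ i < 1)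
    (hE0 : E 0 = 1) (hE : ∀ i, E (i + 1) = E i / (1 - ρ i))
    (hxh : 0 < xh) (hφ : ∀ i, 0 < φ i) (hS : ∀ i j, 0 ≤ S i j) (hc : ∀ i, 0 < c i)
    (hG : ∀ j, G j = 1 + ∑ i ∈ range j, x i * gh i * S i j / (xh * φ j))
    (hgh : ∀ i, i < n → 2 * xh * φ i * G i / c i ≤ gh i)
    (hR : ∀ i j, i < j → j ≤ n → c i * M i / (1 - x i * M i) ≤ 2 * φ i * S i j / φ j) :
    ∀ j, j ≤ n → E j ≤ G j := by
  -- `G ≥ 0` for every index (all summands non-negative once `ĝ ≥ 0`); we only need it below `n`, where `ĝ_i ≥ 2x̂φ_iG_i∕c_i` and `G_i ≥ 1` inductively.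
  intro j
  induction j using Nat.strong_induction_on with
  | _ j ih =>
    intro hj
    rw [hG j]
    refine compounding_le_of_termwise hρ1 hE0 hE fun i hi => ?_
    have hin : i < n := lt_of_lt_of_le hi hj
    have hEG : E i ≤ G i := ih i hi hin.le
    have hGi : 0 ≤ G i := le_trans zero_le_one (le_trans (compounding_ge_one (fun k => by rw [hρ k]; exact mul_nonneg (hx k) (hM k)) hρ1 hE0 hE i) hEG)
    have hρi : x i * M i < 1 := by rw [← hρ i]; exact hρ1 i
    have := own_compounding_le_amplified_read (hx i) (hM i) hρi hEG hGi (hc i) hxh (hφ j) (hS i j) (hgh i hin) (hR i j hi hj)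
    rw [hρ i]
    exact this

end Summit.QuantumFields.BalabanUV.Beta.EriceRemainderEnclosureHistoryAutonomyComparisonAgeCompositionStaticChainSaturationCompounding

end
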